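import Mathlib
import HarnessLib
import Literature.Geometry.DiscreteGeometry.BondGraph
import Literature.Geometry.DiscreteGeometry.KissingPatterns
import Literature.Geometry.DiscreteGeometry.KissingRigidity
import Summits.AtomisticToContinuum.Crystallization.Theorems.PricedLinkCensusSoftLayerPropagationStubChartAssembly
import Summits.AtomisticToContinuum.Crystallization.Theorems.PricedLinkCensusSoftLayerPropagationStubShadowTransition

/-!
# Frames of the shadow development: extension along a bond and the frame equation (crux `SoftLayerPropagation`, line `Sketch`)

Route `PricedLinkCensus`, crux `SoftLayerPropagation` (stmt-AtomisticToContinuum-14233), line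
`Sketch`, helper file for the stub `stub_develop` (development of the exact shadow crystal on a
graph ball): registered sub-goal `develop_extend`.

A site `j` carrying an exact labelled chart `(P, A, m)` (conclusion of `stub_chartAssembly`:
`P ∈ {FCC, HCP}`, `m p` a bond-neighbour within `nn_j/4` of `y j + nn_j • A p`, `m` injective on
`P`, bonds among labelled sites exactly the pattern contacts, every bond-neighbour labelled) is
PLACED by a FRAME `(D, Q)` — a point `D` of shadow space and a linear isometry `Q` — which
develops the star of `j` as `m p ↦ D + Q p`.  Two frames at bonded sites `j ~ k` are
COMPATIBLE when the two developments agree on the common part `{j, k} ∪ (N j ∩ N k)` of the two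
stars (three clauses, written out in full in every statement; no new definitions).

* `develop_extend` (registered): a frame at `j` extends along any bond `j ~ k` to a compatible
  frame at `k` — the transition isometry `L` of `shadow_transition` is invertible; put
  `D' = D + Q p₀`, `Q' = Q ∘ L⁻¹`.
* `develop_frame_eq`: conversely compatibility pins the frame of `k` in terms of the frame of `j`
  (`Q = Q' ∘ L`, `D' = D + Q p₀`), because the labelled bond star contains a contact triangle
  through the label of `k` (`pattern_star_edge`, the real form of the first table of
  `shadow_starTables`) and three pairwise touching unit vectors are a basis of `ℝ³`
  (`linearMap_eq_of_eq_on_unit_triangle`).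

The triangle rule (compatibility is transitive around a bond triangle) and the ordered
development are in the sequel files.  All `[folklore]` (transport of frames along a flat
discrete connection; elementary geometry of the cuboctahedron / anticuboctahedron).
-/

noncomputable section

namespace Summit.AtomisticToContinuum.Crystallization.Theorems

open Literature.Geometry.DiscreteGeometry
open RealInnerProductSpace

set_option maxRecDepth 8000
set_option synthInstance.maxSize 8192
set_option synthInstance.maxHeartbeats 800000

/-! ### Pattern facts -/

/-- In the FCC and the HCP kissing pattern every point `p` touches two points `a, b` which touch
each other (a contact triangle of the cuboctahedron / anticuboctahedron through every vertex;
real form of the first table of `shadow_starTables`). [folklore] -/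
theorem pattern_star_edge (P : Finset (EuclideanSpace ℝ (Fin 3)))
    (hP : P = fccKissingPattern ∨ P = hcpKissingPattern) :
    ∀ p ∈ P, ∃ a ∈ P, ∃ b ∈ P, dist p a = 1 ∧ dist p b = 1 ∧ dist a b = 1 := by
  obtain ⟨S, N, hN, -, rfl, hE, -⟩ := shadow_starTables P hP
  intro p hp
  obtain ⟨v, hv, rfl⟩ := Finset.mem_image.1 hp
  obtain ⟨a, ha, b, hb, h1, h2, h3⟩ := hE v hv
  refine ⟨(Real.sqrt N)⁻¹ • intVec a, Finset.mem_image_of_mem _ ha, (Real.sqrt N)⁻¹ • intVec b,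
    Finset.mem_image_of_mem _ hb, ?_, ?_, ?_⟩
  · rwa [dist_scaled_intVec_eq_one_iff hN]
  · rwa [dist_scaled_intVec_eq_one_iff hN]
  · rwa [dist_scaled_intVec_eq_one_iff hN]

/-- Points of the FCC / HCP pattern are unit vectors. [folklore] -/
theorem norm_eq_one_of_mem_pattern {P : Finset (EuclideanSpace ℝ (Fin 3))}
    (hP : P = fccKissingPattern ∨ P = hcpKissingPattern) {p : EuclideanSpace ℝ (Fin 3)}
    (hp : p ∈ P) : ‖p‖ = 1 := by
  rcases hP with rfl | rfl
  · exact norm_eq_one_of_mem_fccKissingPattern hp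
  · exact norm_eq_one_of_mem_hcpKissingPattern hp

/-- Two unit vectors at distance `1` have inner product `1/2`. [folklore] -/
theorem inner_eq_half_of_dist_eq_one {a b : EuclideanSpace ℝ (Fin 3)} (ha : ‖a‖ = 1) (hb : ‖b‖ = 1)
    (hab : dist a b = 1) : ⟪a, b⟫ = 1 / 2 := by
  have h := norm_sub_sq_real a b
  rw [← dist_eq_norm, hab, ha, hb] at h
  linarith

/-- Three unit vectors with pairwise inner products `1/2` (three pairwise touching kissing
points) are linearly independent. [folklore] -/
theorem linearIndependent_of_unit_triangle {p : Fin 3 → EuclideanSpace ℝ (Fin 3)}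
    (hd : ∀ i, ⟪p i, p i⟫ = 1) (ho : ∀ i j, i ≠ j → ⟪p i, p j⟫ = 1 / 2) : LinearIndependent ℝ p := by
  -- adapted from `linearIndependent_of_gram_triangle` (KissingRigidity)
  rw [Fintype.linearIndependent_iff]
  intro g hg i
  have h : ∀ j, ⟪∑ i, g i • p i, p j⟫ = 0 := fun j => by rw [hg, inner_zero_left]
  have e0 := h 0
  have e1 := h 1
  have e2 := h 2
  simp only [inner_add_left, real_inner_smul_left, Fin.sum_univ_three, hd,
    ho 0 1 (by decide), ho 0 2 (by decide), ho 1 0 (by decide), ho 1 2 (by decide),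
    ho 2 0 (by decide), ho 2 1 (by decide)] at e0 e1 e2
  have g0 : g 0 = 0 := by linarith
  have g1 : g 1 = 0 := by linarith
  have g2 : g 2 = 0 := by linarith
  fin_cases i <;> assumption

/-- Two linear maps of `ℝ³` which agree on three pairwise touching unit vectors agree
everywhere. [folklore] -/
theorem linearMap_eq_of_eq_on_unit_triangle {F G : EuclideanSpace ℝ (Fin 3) →ₗ[ℝ] EuclideanSpace ℝ (Fin 3)}
    {a b c : EuclideanSpace ℝ (Fin 3)} (ha : ‖a‖ = 1) (hb : ‖b‖ = 1) (hc : ‖c‖ = 1)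
    (hab : dist a b = 1) (hac : dist a c = 1) (hbc : dist b c = 1)
    (h1 : F a = G a) (h2 : F b = G b) (h3 : F c = G c) : F = G := by
  have hli : LinearIndependent ℝ ![a, b, c] := by
    refine linearIndependent_of_unit_triangle ?_ ?_
    · intro i
      fin_cases i
      · show ⟪a, a⟫ = 1
        rw [real_inner_self_eq_norm_sq, ha]; norm_num
      · show ⟪b, b⟫ = 1
        rw [real_inner_self_eq_norm_sq, hb]; norm_num
      · show ⟪c, c⟫ = 1
        rw [real_inner_self_eq_norm_sq, hc]; norm_num
    · intro i j hij
      have iab := inner_eq_half_of_dist_eq_one ha hb hab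
      have iac := inner_eq_half_of_dist_eq_one ha hc hac
      have ibc := inner_eq_half_of_dist_eq_one hb hc hbc
      fin_cases i <;> fin_cases j
      all_goals (first | exact absurd rfl hij | skip)
      · simpa using iab
      · simpa using iac
      · simpa [real_inner_comm] using iab
      · simpa using ibc
      · simpa [real_inner_comm] using iac
      · simpa [real_inner_comm] using ibc
  have hspan := hli.span_eq_top_of_card_eq_finrank (by simp)
  refine LinearMap.ext_on_range hspan fun i => ?_
  fin_cases i
  · simpa using h1
  · simpa using h2
  · simpa using h3


/-! ### Extension of a frame along a bond -/

/-- **Extension along a bond.**  Let `j ~ k` be bonded sites with `nn_j > 0`, carrying exact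
labelled charts `(P, A, m)` and `(P', A', m')` (conclusion of `stub_chartAssembly`).  Every frame
`(D, Q)` at `j` extends to a frame `(D', Q')` at `k` COMPATIBLE with it: the two developments
`m p ↦ D + Q p` and `m' p' ↦ D' + Q' p'` agree on the common neighbours, place `k` where the
chart of `j` does and `j` where the chart of `k` does.  (`D' = D + Q p₀`, `Q' = Q ∘ L⁻¹` for the
transition isometry `L` of `shadow_transition` and the label `p₀` of `k` at `j`.) [folklore] -/
theorem develop_extend :  ∀ (η : ℝ) (N : ℕ) (y : Fin N → EuclideanSpace ℝ (Fin 3)) (j k : Fin N),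
    0 < Literature.Geometry.DiscreteGeometry.nearestDist y j →
    (Literature.Geometry.DiscreteGeometry.bondGraph η y).Adj j k → ∀ (P : Finset (EuclideanSpace ℝ
    (Fin 3))) (A : EuclideanSpace ℝ (Fin 3) →ₗᵢ[ℝ] EuclideanSpace ℝ (Fin 3)) (m : EuclideanSpace ℝ
    (Fin 3) → Fin N), (P = Literature.Geometry.DiscreteGeometry.fccKissingPattern ∨ P =
    Literature.Geometry.DiscreteGeometry.hcpKissingPattern) → (∀ p ∈ P,
    (Literature.Geometry.DiscreteGeometry.bondGraph η y).Adj j (m p) ∧ dist (y (m p)) (y j +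
    Literature.Geometry.DiscreteGeometry.nearestDist y j • A p) ≤
    Literature.Geometry.DiscreteGeometry.nearestDist y j / 4) → (∀ p ∈ P, ∀ q ∈ P, m p = m q → p =
    q) → (∀ p ∈ P, ∀ q ∈ P, ((Literature.Geometry.DiscreteGeometry.bondGraph η y).Adj (m p) (m q) ↔
    dist p q = 1)) → (∀ l, (Literature.Geometry.DiscreteGeometry.bondGraph η y).Adj j l → ∃ p ∈ P, m
    p = l) → ∀ (P' : Finset (EuclideanSpace ℝ (Fin 3))) (A' : EuclideanSpace ℝ (Fin 3) →ₗᵢ[ℝ]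
    EuclideanSpace ℝ (Fin 3)) (m' : EuclideanSpace ℝ (Fin 3) → Fin N), (P' =
    Literature.Geometry.DiscreteGeometry.fccKissingPattern ∨ P' =
    Literature.Geometry.DiscreteGeometry.hcpKissingPattern) → (∀ p ∈ P',
    (Literature.Geometry.DiscreteGeometry.bondGraph η y).Adj k (m' p) ∧ dist (y (m' p)) (y k +
    Literature.Geometry.DiscreteGeometry.nearestDist y k • A' p) ≤
    Literature.Geometry.DiscreteGeometry.nearestDist y k / 4) → (∀ p ∈ P', ∀ q ∈ P', m' p = m' q → p
    = q) → (∀ p ∈ P', ∀ q ∈ P', ((Literature.Geometry.DiscreteGeometry.bondGraph η y).Adj (m' p) (m'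
    q) ↔ dist p q = 1)) → (∀ l, (Literature.Geometry.DiscreteGeometry.bondGraph η y).Adj k l → ∃ p ∈
    P', m' p = l) → ∀ (D : EuclideanSpace ℝ (Fin 3)) (Q : EuclideanSpace ℝ (Fin 3) →ₗᵢ[ℝ]
    EuclideanSpace ℝ (Fin 3)), ∃ (D' : EuclideanSpace ℝ (Fin 3)) (Q' : EuclideanSpace ℝ (Fin 3)
    →ₗᵢ[ℝ] EuclideanSpace ℝ (Fin 3)), (∀ p ∈ P, ∀ p' ∈ P', m p = m' p' → D + Q p = D' + Q' p') ∧ (∀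
    p ∈ P, m p = k → D + Q p = D') ∧ (∀ p' ∈ P', m' p' = j → D' + Q' p' = D) := by
  intro η n y j k hν hjk P A m hP C2 C3 C4 C5 P' A' m' hP' C2' C3' C4' C5' D Q
  obtain ⟨L, hL⟩ := shadow_transition η n y j k hν hjk P A m hP C2 C3 C4 C5 P' A' m' hP' C2' C3' C4' C5'
  obtain ⟨p₀, hp₀, hp₀k⟩ := C5 k hjk
  obtain ⟨p₀', hp₀', hp₀'j⟩ := C5' j hjk.symm
  obtain ⟨hL0, hLq⟩ := hL p₀ hp₀ p₀' hp₀' hp₀k hp₀'j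
  set Le : EuclideanSpace ℝ (Fin 3) ≃ₗᵢ[ℝ] EuclideanSpace ℝ (Fin 3) := L.toLinearIsometryEquiv rfl
    with hLe
  have hLe_apply : ∀ x, Le x = L x := fun x => rfl
  refine ⟨D + Q p₀, Q.comp Le.symm.toLinearIsometry, ?_, ?_, ?_⟩
  · intro q hq q' hq' hqq'
    have h1 : L q = q' - p₀' := hLq q hq q' hq' hqq'
    have h2 : Le.symm q' = q - p₀ := by
      apply Le.injective
      rw [LinearIsometryEquiv.apply_symm_apply, hLe_apply, map_sub, h1, hL0, sub_neg_eq_add,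
        sub_add_cancel]
    simp only [LinearIsometry.coe_comp, Function.comp_apply, LinearIsometryEquiv.coe_toLinearIsometry,
      h2, map_sub]
    abel
  · intro p hp hpk
    obtain rfl : p = p₀ := C3 p hp p₀ hp₀ (hpk.trans hp₀k.symm)
    rfl
  · intro p' hp' hp'j
    obtain rfl : p' = p₀' := C3' p' hp' p₀' hp₀' (hp'j.trans hp₀'j.symm)
    have h2 : Le.symm p' = -p₀ := by
      apply Le.injective
      rw [LinearIsometryEquiv.apply_symm_apply, hLe_apply, map_neg, hL0, neg_neg]
    simp only [LinearIsometry.coe_comp, Function.comp_apply, LinearIsometryEquiv.coe_toLinearIsometry,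
      h2, map_neg]
    abel

/-! ### The frame equation of a compatible pair -/

/-- **Frame equation.**  If the frames `(D, Q)` at `j` and `(D', Q')` at `k ~ j` are compatible,
and `L` is a transition isometry of the bond (`L p₀ = −p₀'`, `L q = q' − p₀'` on corresponding
labels of common neighbours, as produced by `shadow_transition`), then `Q = Q' ∘ L` and
`D' = D + Q p₀`: compatibility on the labelled bond star (which contains a contact triangle, hence
a basis) pins the whole frame. [folklore] -/
theorem develop_frame_eq {η : ℝ} {N : ℕ} {y : Fin N → EuclideanSpace ℝ (Fin 3)} {j k : Fin N}
    {P : Finset (EuclideanSpace ℝ (Fin 3))} {m : EuclideanSpace ℝ (Fin 3) → Fin N}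
    (hP : P = fccKissingPattern ∨ P = hcpKissingPattern)
    (C4 : ∀ p ∈ P, ∀ q ∈ P, ((bondGraph η y).Adj (m p) (m q) ↔ dist p q = 1))
    {P' : Finset (EuclideanSpace ℝ (Fin 3))} {m' : EuclideanSpace ℝ (Fin 3) → Fin N}
    (C5' : ∀ l, (bondGraph η y).Adj k l → ∃ p ∈ P', m' p = l)
    {p₀ : EuclideanSpace ℝ (Fin 3)} (hp₀ : p₀ ∈ P) (hp₀k : m p₀ = k)
    {p₀' : EuclideanSpace ℝ (Fin 3)} (hp₀' : p₀' ∈ P') (hp₀'j : m' p₀' = j)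
    {L : EuclideanSpace ℝ (Fin 3) →ₗᵢ[ℝ] EuclideanSpace ℝ (Fin 3)} (hL0 : L p₀ = -p₀')
    (hLq : ∀ q ∈ P, ∀ q' ∈ P', m q = m' q' → L q = q' - p₀')
    {D D' : EuclideanSpace ℝ (Fin 3)} {Q Q' : EuclideanSpace ℝ (Fin 3) →ₗᵢ[ℝ] EuclideanSpace ℝ (Fin 3)}
    (hc1 : ∀ p ∈ P, ∀ p' ∈ P', m p = m' p' → D + Q p = D' + Q' p')
    (hc2 : ∀ p ∈ P, m p = k → D + Q p = D')
    (hc3 : ∀ p' ∈ P', m' p' = j → D' + Q' p' = D) :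
    (∀ z, Q z = Q' (L z)) ∧ D' = D + Q p₀ := by
  have hD' : D' = D + Q p₀ := (hc2 p₀ hp₀ hp₀k).symm
  refine ⟨?_, hD'⟩
  -- `Q` and `Q' ∘ L` agree on `p₀`
  have e0 : Q p₀ = Q' (L p₀) := by
    have h := hc3 p₀' hp₀' hp₀'j
    rw [hD', hL0, map_neg] at *
    -- h : D + Q p₀ + Q' p₀' = D
    have : Q p₀ + Q' p₀' = 0 := by
      have := congrArg (fun z => z - D) h
      simpa [add_assoc, add_sub_cancel_left] using this
    exact eq_neg_of_add_eq_zero_left this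
  -- and on the label of every common neighbour
  have e1 : ∀ q ∈ P, dist p₀ q = 1 → Q q = Q' (L q) := by
    intro q hq hdq
    have hadj : (bondGraph η y).Adj k (m q) := by rw [← hp₀k]; exact (C4 p₀ hp₀ q hq).2 hdq
    obtain ⟨q', hq', hqq'⟩ := C5' _ hadj
    have h := hc1 q hq q' hq' hqq'.symm
    rw [hLq q hq q' hq' hqq'.symm, map_sub, hD'] at *
    -- h : D + Q q = D + Q p₀ + Q' q'
    have h' : Q q = Q p₀ + Q' q' := by
      have := congrArg (fun z => -D + z) h
      simpa [add_assoc] using this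
    rw [h', e0, hL0, map_neg]
    abel
  -- a contact triangle `p₀, a, b` of the pattern is a basis
  obtain ⟨a, ha, b, hb, h0a, h0b, hab⟩ := pattern_star_edge P hP p₀ hp₀
  have key : Q.toLinearMap = Q'.toLinearMap ∘ₗ L.toLinearMap :=
    linearMap_eq_of_eq_on_unit_triangle (norm_eq_one_of_mem_pattern hP hp₀)
      (norm_eq_one_of_mem_pattern hP ha) (norm_eq_one_of_mem_pattern hP hb) h0a h0b hab
      (by simpa using e0) (by simpa using e1 a ha h0a) (by simpa using e1 b hb h0b)
  intro z
  simpa using congrArg (fun F => F z) key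

end Summit.AtomisticToContinuum.Crystallization.Theorems

end
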